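import Summits.ResolutionOfSingularities.ResolutionOfSingularities.Theorems.EquisingularLiftEquisingularLiftNatDirZeroDefs
import Literature.AlgebraicGeometry.Resolution.StalkIdealLemmas
import Literature.AlgebraicGeometry.Resolution.MarkedIdealsLemmas
import Literature.AlgebraicGeometry.Resolution.SNCStrataSmooth
import HarnessLib

/-!
# [OURS · L1 W4.5(b) · EL♮(3)] NOSE ENGINE CERTIFICATION ‖ K — the «nose is a curve» clause for DISJOINT UNIONS
# (local rings of `(Z₁ ∪ Z₂)_red` at closed points are those of `(Z₁)_red` / `(Z₂)_red`)

Cell `res-hironaka`, slot W4.5(b); crux **EL♮(3)** (stmt-ResolutionOfSingularities-20148); width seat res-L1-w45b-nose-w3, row «NOSE ENGINE CERT ‖ K» of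
res-L1-w45b-plan-1's WIDTH TABLE D1′. `--supports stmt-ResolutionOfSingularities-20148 --as helper`; closes nothing. OURS; NOT a statement of any
manuscript; AI-written, weaker than expert review. No definition, no `sorry`, standard axioms.

WHY. The nose predicates (`ReachNoseTowerBTriplePrime`, p628165; the rounds' `hZdim`) carry the clause «every closed point of the reduced nose `Z_red` has a
one-dimensional local ring». For the `union` constructor of `IsLiftableNoseClass₂` (census class C0a «two skew double lines», PLANNER-MEMO-g10-1) the clause must be
inherited from the pieces. This file proves the inheritance for ANY scheme and ANY target dimension `d`:

* `forall_ringKrullDim_stalk_redSub_union` — for disjoint closed `Z₁, Z₂ ⊆ X`, if the closed points of `(Z₁)_red` and of `(Z₂)_red` have local rings of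
  dimension `d`, so do the closed points of `(Z₁ ∪ Z₂)_red`: `𝓘⟨Z₁ ∪ Z₂⟩ = 𝓘⟨Z₁⟩ ⊓ 𝓘⟨Z₂⟩` (Mathlib `vanishingIdeal_sup`), stalkwise `𝓘⟨Z₂⟩_x = ⊤` off `Z₂`
  (`stalkIdeal_eq_top_of_not_mem_support`, `stalkIdeal_inf`), and `𝒪_{V(𝓘),z} ≅ 𝒪_{X,x}/𝓘_x` (`ringKrullDim_stalk_subscheme`); closedness of the point
  transports along the closed immersions.
* `infinite_union_of_left` — the companion clause `Z.Infinite` is inherited trivially.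

With `WhitneyCubic.doubleLine_curve` (p642717) for `V(x₂, x₃)` (and its image under a coordinate permutation for `V(x₀, x₁)`) this is the curve clause of the
skew-lines nose `V(x₀,x₁) ∪ V(x₂,x₃)`; the remaining input of a C0a certificate is the chart algebra of the (2,2)-scroll (NOSE-CERT-CENSUS §2).
-/

set_option linter.dupNamespace false -- mandated namespace `Summit.<Summit>.<Problem>` of this single-conjunct summit

noncomputable section

open CategoryTheory AlgebraicGeometry TopologicalSpace
open Literature.AlgebraicGeometry.Resolution
open AlgebraicGeometry.Scheme.IdealSheafData

namespace Summit.ResolutionOfSingularities.ResolutionOfSingularities.Cruxes.EquisingularLiftNat.Sections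

namespace NoseCert

/-- A point of `V(𝓘⟨Z⟩)` lies over `Z`. [folklore] -/
theorem redSubι_mem {X : Scheme.{0}} {Z : Set X} {hZ : IsClosed Z} (z : ↥(redSub X Z hZ)) : (redSubι X Z hZ z : X) ∈ Z := by
  have h : (redSubι X Z hZ z : X) ∈ Set.range (redSubι X Z hZ) := ⟨z, rfl⟩
  rw [Scheme.IdealSheafData.range_subschemeι, Scheme.IdealSheafData.coe_support_vanishingIdeal] at h
  exact h

/-- A closed point of a closed subscheme maps to a closed point. [folklore] -/
theorem isClosed_image_singleton {X : Scheme.{0}} {Z : Set X} {hZ : IsClosed Z} {z : ↥(redSub X Z hZ)}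
    (hz : IsClosed ({z} : Set ↥(redSub X Z hZ))) : IsClosed ({(redSubι X Z hZ z : X)} : Set X) := by
  have h := (redSubι X Z hZ).isClosedEmbedding.isClosedMap _ hz
  rwa [Set.image_singleton] at h

/-- The point of `V(𝓘⟨Z⟩)` over a closed point of `Z` is closed. [folklore] -/
theorem isClosed_singleton_of_apply {X : Scheme.{0}} {Z : Set X} {hZ : IsClosed Z} (z : ↥(redSub X Z hZ))
    (hx : IsClosed ({(redSubι X Z hZ z : X)} : Set X)) : IsClosed ({z} : Set ↥(redSub X Z hZ)) := by
  have h : (redSubι X Z hZ) ⁻¹' {(redSubι X Z hZ z : X)} = {z} := by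
    ext w
    simp only [Set.mem_preimage, Set.mem_singleton_iff]
    exact (redSubι X Z hZ).isClosedEmbedding.injective.eq_iff
  rw [← h]
  exact hx.preimage (redSubι X Z hZ).continuous

/-- **Local dimension of `(Z₁ ∪ Z₂)_red` at a point over `Z₁`, for disjoint closed `Z₁, Z₂`**: it is the local dimension of `(Z₁)_red` at the point over the
same `x` — `𝓘⟨Z₁ ∪ Z₂⟩_x = 𝓘⟨Z₁⟩_x ⊓ 𝓘⟨Z₂⟩_x = 𝓘⟨Z₁⟩_x` (`x ∉ Z₂`) and `𝒪_{V(𝓘),z} ≅ 𝒪_{X,x}/𝓘_x`. [folklore] -/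
theorem ringKrullDim_stalk_redSub_union_eq_left {X : Scheme.{0}} {Z₁ Z₂ : Set X} (h₁ : IsClosed Z₁) (h₂ : IsClosed Z₂)
    (hdisj : Disjoint Z₁ Z₂) (z : ↥(redSub X (Z₁ ∪ Z₂) (h₁.union h₂))) (z₁ : ↥(redSub X Z₁ h₁))
    (hzz : (redSubι X Z₁ h₁ z₁ : X) = redSubι X (Z₁ ∪ Z₂) (h₁.union h₂) z) :
    ringKrullDim ((redSub X (Z₁ ∪ Z₂) (h₁.union h₂)).presheaf.stalk z) = ringKrullDim ((redSub X Z₁ h₁).presheaf.stalk z₁) := by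
  have hx₁ : (redSubι X Z₁ h₁ z₁ : X) ∈ Z₁ := redSubι_mem z₁
  have hx₂ : (redSubι X Z₁ h₁ z₁ : X) ∉ Z₂ := fun h => Set.disjoint_left.mp hdisj hx₁ h
  have hsup : (⟨Z₁ ∪ Z₂, h₁.union h₂⟩ : Closeds X) = (⟨Z₁, h₁⟩ : Closeds X) ⊔ ⟨Z₂, h₂⟩ := Closeds.ext rfl
  have hnot : (redSubι X Z₁ h₁ z₁ : X) ∉ (vanishingIdeal (⟨Z₂, h₂⟩ : Closeds X)).support := by
    rw [← SetLike.mem_coe, Scheme.IdealSheafData.coe_support_vanishingIdeal]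
    exact hx₂
  have hstalk : stalkIdeal (vanishingIdeal (⟨Z₁ ∪ Z₂, h₁.union h₂⟩ : Closeds X)) (redSubι X Z₁ h₁ z₁ : X) =
      stalkIdeal (vanishingIdeal (⟨Z₁, h₁⟩ : Closeds X)) (redSubι X Z₁ h₁ z₁ : X) := by
    rw [hsup, vanishingIdeal_sup, stalkIdeal_inf, stalkIdeal_eq_top_of_not_mem_support hnot, inf_top_eq]
  rw [ringKrullDim_stalk_subscheme, ringKrullDim_stalk_subscheme]
  change ringKrullDim (X.presheaf.stalk (redSubι X (Z₁ ∪ Z₂) (h₁.union h₂) z : X) ⧸ _) =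
    ringKrullDim (X.presheaf.stalk (redSubι X Z₁ h₁ z₁ : X) ⧸ _)
  rw [← hzz, hstalk]

/-- **THE «NOSE IS A CURVE» CLAUSE FOR DISJOINT UNIONS**: for disjoint closed `Z₁, Z₂ ⊆ X`, if the closed points of `(Z₁)_red` and of `(Z₂)_red` have local rings
of dimension `d`, so do the closed points of `(Z₁ ∪ Z₂)_red`. [folklore] -/
theorem forall_ringKrullDim_stalk_redSub_union {X : Scheme.{0}} {Z₁ Z₂ : Set X} (h₁ : IsClosed Z₁) (h₂ : IsClosed Z₂)
    (hdisj : Disjoint Z₁ Z₂) {d : WithBot ℕ∞}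
    (H₁ : ∀ z : ↥(redSub X Z₁ h₁), IsClosed ({z} : Set ↥(redSub X Z₁ h₁)) → ringKrullDim ((redSub X Z₁ h₁).presheaf.stalk z) = d)
    (H₂ : ∀ z : ↥(redSub X Z₂ h₂), IsClosed ({z} : Set ↥(redSub X Z₂ h₂)) → ringKrullDim ((redSub X Z₂ h₂).presheaf.stalk z) = d) :
    ∀ z : ↥(redSub X (Z₁ ∪ Z₂) (h₁.union h₂)), IsClosed ({z} : Set ↥(redSub X (Z₁ ∪ Z₂) (h₁.union h₂))) →
      ringKrullDim ((redSub X (Z₁ ∪ Z₂) (h₁.union h₂)).presheaf.stalk z) = d := by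
  intro z hz
  have hx : IsClosed ({(redSubι X (Z₁ ∪ Z₂) (h₁.union h₂) z : X)} : Set X) := isClosed_image_singleton hz
  rcases redSubι_mem z with hZ₁ | hZ₂
  · -- over `Z₁`
    have hrange : (redSubι X (Z₁ ∪ Z₂) (h₁.union h₂) z : X) ∈ Set.range (redSubι X Z₁ h₁) := by
      rw [Scheme.IdealSheafData.range_subschemeι, Scheme.IdealSheafData.coe_support_vanishingIdeal]
      exact hZ₁
    obtain ⟨z₁, hz₁⟩ := hrange
    rw [ringKrullDim_stalk_redSub_union_eq_left h₁ h₂ hdisj z z₁ hz₁]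
    exact H₁ z₁ (isClosed_singleton_of_apply z₁ (by rw [hz₁]; exact hx))
  · -- over `Z₂`: symmetric
    have hrange : (redSubι X (Z₁ ∪ Z₂) (h₁.union h₂) z : X) ∈ Set.range (redSubι X Z₂ h₂) := by
      rw [Scheme.IdealSheafData.range_subschemeι, Scheme.IdealSheafData.coe_support_vanishingIdeal]
      exact hZ₂
    obtain ⟨z₂, hz₂⟩ := hrange
    have hunion : (Z₁ ∪ Z₂) = (Z₂ ∪ Z₁) := Set.union_comm _ _
    -- re-run the left case with the roles of `Z₁`, `Z₂` exchanged, transporting along `Z₁ ∪ Z₂ = Z₂ ∪ Z₁`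
    have key : ∀ (W : Set X) (hW : IsClosed W) (hWeq : W = Z₂ ∪ Z₁) (w : ↥(redSub X W hW)),
        (redSubι X Z₂ h₂ z₂ : X) = redSubι X W hW w → IsClosed ({(redSubι X W hW w : X)} : Set X) →
        ringKrullDim ((redSub X W hW).presheaf.stalk w) = d := by
      intro W hW hWeq w hww hxw
      subst hWeq
      rw [ringKrullDim_stalk_redSub_union_eq_left h₂ h₁ hdisj.symm w z₂ hww]
      exact H₂ z₂ (isClosed_singleton_of_apply z₂ (by rw [hww]; exact hxw))
    exact key (Z₁ ∪ Z₂) (h₁.union h₂) hunion z hz₂ hx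

/-- The companion clause: a union with an infinite piece is infinite. [folklore] -/
theorem infinite_union_of_left {α : Type*} {Z₁ Z₂ : Set α} (h : Z₁.Infinite) : (Z₁ ∪ Z₂).Infinite :=
  h.mono Set.subset_union_left

end NoseCert

end Summit.ResolutionOfSingularities.ResolutionOfSingularities.Cruxes.EquisingularLiftNat.Sections

end
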